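import Mathlib.RingTheory.AlgebraicIndependent.Transcendental
import Mathlib.Algebra.Algebra.Hom.Rat
import Mathlib.FieldTheory.IntermediateField.Adjoin.Defs
import Mathlib.Analysis.SpecialFunctions.Complex.Log
import Literature.ModelTheory.ExponentialFields.Languages
import HarnessLib

-- provenance: harness21/H21/H21/Prelude/TranscendEllArithS/ExponentialField.lean @ 7998fb0 (interim HEAD d8f2665); M5 mechanical rewrite
/-!
# Exponential rings and fields: homomorphisms, kernel, the Schanuel property

Trunk `TranscendEllArithS`, concept C6 (`exponential_field`), building on the class
`Literature.ModelTheory.ExponentialFields.ExponentialRing` of `Literature.Prelude.TranscendEllArithS.Languages` (C5).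

Contents:

* `Literature.ExponentialRingHom R S`: ring homomorphisms commuting with `exp` (E-ring morphisms,
  van den Dries 1984; Kirby 2013 §2), with `FunLike`/`RingHomClass` instances, `id`, `comp`, and
  the inclusion `ℝ → ℂ` (`ExponentialRingHom.realComplex`).
* `Literature.ExponentialRing.expKernel R : AddSubgroup R`, the kernel `{x | exp x = 1}` of the exponential
  (Zilber 2005 §1, condition "ker exp = ωℤ"; Kirby 2013 Def. 2.5); `expKernel_real : expKernel ℝ = ⊥`,
  `mem_expKernel_complex_iff : x ∈ expKernel ℂ ↔ x ∈ 2πiℤ`.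
* `Literature.ExponentialRing.IsSurjectiveOntoUnits R`: every nonzero element is an exponential
  (Zilber's surjectivity axiom for pseudo-exponentiation, Zilber 2005 §1; "EL-field", Kirby 2013
  Def. 2.10). This is a *predicate* on exponential rings (an axiom of Zilber fields), not a theorem:
  it holds for `ℂ_exp` (`isSurjectiveOntoUnits_complex`) and fails for `ℝ_exp`
  (`not_isSurjectiveOntoUnits_real` in `ExponentialFieldProofs.lean`), so there is no
  `IsSurjectiveOntoUnits_holds`; users keep `(h : IsSurjectiveOntoUnits K)` as a hypothesis.
* `Literature.SchanuelProperty R`: the Schanuel property of an exponential field of characteristic zero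
  (Lang 1966 p. 30 for `ℂ`; Zilber 2005 §1; Kirby 2013 Def. 2.8): if `x₁, …, xₙ` are `ℚ`-linearly
  independent then `trdeg_ℚ ℚ(x, exp x) ≥ n`. It has *literally* the shape of
  `Literature.Periods.SchanuelConjecture` (`H21/Statements/Periods/Wave0.lean`), so that
  `SchanuelProperty ℂ ↔ SchanuelConjecture` holds by `Iff.rfl` (stated in the statements layer, not
  here: this Prelude file does not import `Wave0`).
* Transfer: `SchanuelProperty.of_injective` (a sub-exponential-field of a Schanuel field is Schanuel)
  and `schanuelProperty_real_of_complex`, both **discharged** below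
  (`SchanuelProperty.of_injective_holds`, `schanuelProperty_real_of_complex_holds`) via
  `ExponentialRingHom.lift_trdeg_adjoin_eq` (an E-field embedding preserves `trdeg_ℚ ℚ(x, exp x)`).
* `not_schanuelProperty_of_exp_eq_one`, `exists_exponentialRing_not_schanuelProperty`: the Schanuel
  property is a *property* (for `ℂ_exp`: Schanuel's *conjecture*, Lang 1966 pp. 30–31, Baker 1975
  p. 112 "a general conjecture, attributed to Schanuel"), not a theorem about all exponential fields —
  it fails for the trivial exponential `exp = 1` (e.g. on `ℚ`). Hence there is no unconditional
  `SchanuelProperty_holds`; users keep `(h : SchanuelProperty R)` as a hypothesis.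

## Mathlib search

Mathlib has `Real.exp_eq_one_iff`, `Complex.exp_eq_one_iff`, `Complex.ofReal_exp`,
`Algebra.trdeg`, `IntermediateField.adjoin`, `LinearIndependent`, and the `ℚ`-algebra instance
`DivisionRing.toRatAlgebra` on characteristic-zero division rings. It has no exponential rings,
no E-ring morphisms and no Schanuel property/conjecture (grep for `Schanuel`, `ExponentialRing`
returns nothing).

## Design choices

* `ExponentialRingHom` extends `RingHom` (bundled, Mathlib style, like `AlgHom`), with the extra
  field `map_exp'` stated via `toFun` and restated as the `simp` lemma `map_exp` through the coercion.
* `expKernel` is an `AddSubgroup` (closed under negation because `exp x` is a unit with inverse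
  `exp (-x)`), valid over any exponential ring.
* `SchanuelProperty` quantifies over `Fin n`-indexed tuples and compares `(n : Cardinal)` with
  `Algebra.trdeg ℚ ↥(IntermediateField.adjoin ℚ (range x ∪ range (exp ∘ x)))`, exactly as Wave0.
* In `SchanuelProperty.of_injective` the E-ring morphism `f : R → S` between fields is automatically
  injective (`RingHom.injective`), so no separate injectivity hypothesis is taken; the name records
  the mathematical content (transfer along an embedding).

## References

* S. Lang, *Introduction to transcendental numbers*, Addison-Wesley (1966), p. 30–31.
* A. Baker, *Transcendental number theory*, Cambridge University Press (1975), p. 112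
  (Schanuel's conjecture).
* L. van den Dries, *Exponential rings, exponential polynomials and exponential functions*,
  Pacific J. Math. 113 (1984).
* B. Zilber, *Pseudo-exponentiation on algebraically closed fields of characteristic zero*,
  Ann. Pure Appl. Logic 132 (2005), §1.
* J. Kirby, *Finitely presented exponential fields*, Algebra & Number Theory 7 (2013), §2.
-/

noncomputable section

open FirstOrder

namespace Literature.ModelTheory.ExponentialFields

/-! ### Morphisms of exponential rings -/

/-- A *morphism of exponential rings* (E-ring homomorphism; van den Dries 1984 §1, Kirby 2013 §2):
a ring homomorphism `f : R →+* S` with `f (exp x) = exp (f x)` for all `x`. [cite: Dries1984, §1  Kirby 2013 §2] -/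
structure ExponentialRingHom (R S : Type*) [Ring R] [Ring S] [ExponentialRing R]
    [ExponentialRing S] extends R →+* S where
  /-- An E-ring morphism commutes with the exponential maps. -/
  map_exp' : ∀ x, toFun (ExponentialRing.exp x) = ExponentialRing.exp (toFun x)

namespace ExponentialRingHom

variable {R S T : Type*} [Ring R] [Ring S] [Ring T] [ExponentialRing R] [ExponentialRing S]
  [ExponentialRing T]

/-- E-ring morphisms are functions (Mathlib `FunLike` boilerplate). [folklore] -/
instance instFunLike : FunLike (ExponentialRingHom R S) R S where
  coe f := f.toRingHom
  coe_injective f g h := by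
    obtain ⟨f, _⟩ := f
    obtain ⟨g, _⟩ := g
    congr
    exact DFunLike.coe_injective h

/-- E-ring morphisms are ring homomorphisms (Mathlib `RingHomClass` boilerplate). [folklore] -/
instance instRingHomClass : RingHomClass (ExponentialRingHom R S) R S where
  map_add f := f.toRingHom.map_add
  map_mul f := f.toRingHom.map_mul
  map_zero f := f.toRingHom.map_zero
  map_one f := f.toRingHom.map_one

/-- The coercion of an E-ring morphism to a function is that of its underlying ring hom. [folklore] -/
@[simp] theorem coe_toRingHom (f : ExponentialRingHom R S) : ⇑f.toRingHom = f := rfl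

/-- An E-ring morphism commutes with `exp` (van den Dries 1984 §1). [cite: Dries1984, §1] -/
@[simp] theorem map_exp (f : ExponentialRingHom R S) (x : R) :
    f (ExponentialRing.exp x) = ExponentialRing.exp (f x) :=
  f.map_exp' x

/-- Two E-ring morphisms are equal if they agree pointwise. [folklore] -/
@[ext] theorem ext {f g : ExponentialRingHom R S} (h : ∀ x, f x = g x) : f = g :=
  DFunLike.ext f g h

variable (R) in
/-- The identity E-ring morphism (van den Dries 1984 §1). [cite: Dries1984, §1] -/
protected def id : ExponentialRingHom R R where
  toRingHom := RingHom.id R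
  map_exp' _ := rfl

/-- The identity E-ring morphism is the identity function. [folklore] -/
@[simp] theorem id_apply (x : R) : ExponentialRingHom.id R x = x := rfl

/-- Composition of E-ring morphisms (van den Dries 1984 §1: E-rings form a category). [cite: Dries1984, §1: E-rings form a category] -/
def comp (g : ExponentialRingHom S T) (f : ExponentialRingHom R S) : ExponentialRingHom R T where
  toRingHom := g.toRingHom.comp f.toRingHom
  map_exp' x := by
    change g (f (ExponentialRing.exp x)) = ExponentialRing.exp (g (f x))
    rw [map_exp, map_exp]

/-- Unfolding lemma for `comp`. [folklore] -/
@[simp] theorem comp_apply (g : ExponentialRingHom S T) (f : ExponentialRingHom R S) (x : R) :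
    g.comp f x = g (f x) := rfl

/-- The inclusion `ℝ → ℂ` is an E-ring morphism from `(ℝ, Real.exp)` to `(ℂ, Complex.exp)`
(Mathlib's `Complex.ofRealHom` and `Complex.ofReal_exp`). [folklore] -/
def realComplex : ExponentialRingHom ℝ ℂ where
  toRingHom := Complex.ofRealHom
  map_exp' x := Complex.ofReal_exp x

/-- `realComplex` is the coercion `ℝ → ℂ`. [folklore] -/
@[simp] theorem realComplex_apply (x : ℝ) : realComplex x = (x : ℂ) := rfl

end ExponentialRingHom

/-! ### The kernel of the exponential and surjectivity -/

namespace ExponentialRing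

variable (R : Type*) [Ring R] [ExponentialRing R]

/-- The *kernel* of the exponential of an exponential ring, the additive subgroup
`{x | exp x = 1}` (Zilber 2005 §1, where the condition `ker exp = ωℤ` is imposed; Kirby 2013 §2). [cite: Zilber2005, §1 (condition ker ex = ωℤ)] -/
def expKernel : AddSubgroup R where
  carrier := {x | exp x = 1}
  zero_mem' := exp_zero
  add_mem' {x y} hx hy := by
    simp only [Set.mem_setOf_eq] at hx hy ⊢
    rw [exp_add, hx, hy, one_mul]
  neg_mem' {x} hx := by
    simp only [Set.mem_setOf_eq] at hx ⊢
    simpa [hx] using exp_mul_exp_neg x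

variable {R} in
/-- Membership in `expKernel` (by definition). [folklore] -/
@[simp] theorem mem_expKernel_iff (x : R) : x ∈ expKernel R ↔ exp x = 1 := Iff.rfl

/-- An exponential ring `R` (intended: a field) has *surjective exponential* if every nonzero
element is of the form `exp x`. This is an **axiom** on exponential fields — part of Zilber's
definition of the basic class `𝓔` of pseudo-exponential fields (`ex : (F, +) → (F*, ·)` is a
*surjective* homomorphism, Zilber 2005 §1), i.e. `R` is an *EL-field* ("every non-zero element has
a logarithm", Kirby 2013 Def. 2.10) — hence a *predicate* (the ring `R` is an explicit argument),
used as a hypothesis `(h : IsSurjectiveOntoUnits K)`; it is not a theorem about exponential rings: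
`ℂ_exp` satisfies it (`isSurjectiveOntoUnits_complex`), `ℝ_exp` does not
(`not_isSurjectiveOntoUnits_real`, file `ExponentialFieldProofs.lean`).
[cite: Zilber2005, §1 (ex surjective onto F*)] [cite: Kirby2013, Definition 2.10] -/
def IsSurjectiveOntoUnits (R : Type*) [Ring R] [ExponentialRing R] : Prop :=
  ∀ y : R, y ≠ 0 → ∃ x : R, exp x = y

/-- The real exponential has trivial kernel: `Real.exp x = 1 ↔ x = 0`
(Mathlib's `Real.exp_eq_one_iff`). [folklore] -/
theorem expKernel_real : expKernel ℝ = ⊥ := by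
  ext x
  simp [Real.exp_eq_one_iff]

/-- The kernel of the complex exponential is `2πiℤ` (Mathlib's `Complex.exp_eq_one_iff`);
this is Zilber's condition `ker exp = ωℤ` for `ℂ_exp` (Zilber 2005 §1). [cite: Zilber2005, §1] -/
theorem mem_expKernel_complex_iff (x : ℂ) :
    x ∈ expKernel ℂ ↔ ∃ n : ℤ, x = n * (2 * Real.pi * Complex.I) := by
  simp [Complex.exp_eq_one_iff]

/-- The complex exponential is surjective onto `ℂˣ` (Mathlib's `Complex.exp_log`). [folklore] -/
theorem isSurjectiveOntoUnits_complex : IsSurjectiveOntoUnits ℂ :=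
  fun y hy => ⟨Complex.log y, by simp [Complex.exp_log hy]⟩

end ExponentialRing

/-! ### The Schanuel property -/

section Schanuel

variable (R : Type*) [Field R] [CharZero R] [ExponentialRing R]

/-- The *Schanuel property* of an exponential field `R` of characteristic zero (Lang 1966 p. 30
for `ℂ`; Zilber 2005 §1, property (SP); Kirby 2013 Def. 2.8): for every `n` and every
`ℚ`-linearly independent tuple `x₁, …, xₙ ∈ R`, the field `ℚ(x₁, …, xₙ, exp x₁, …, exp xₙ)` has
transcendence degree at least `n` over `ℚ`. For `R = ℂ` this is (definitionally) Schanuel's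
conjecture `Literature.Periods.SchanuelConjecture`. [cite: Lang1966, p. 30 for  ℂ] -/
def SchanuelProperty (R : Type*) [Field R] [CharZero R] [ExponentialRing R] : Prop :=
  ∀ (n : ℕ) (x : Fin n → R), LinearIndependent ℚ x →
    (n : Cardinal) ≤ Algebra.trdeg ℚ
      ↥(IntermediateField.adjoin ℚ (Set.range x ∪ Set.range (ExponentialRing.exp ∘ x)))

variable {R} {S : Type*} [Field S] [CharZero S] [ExponentialRing S]

/-- Transfer of the Schanuel property along an embedding of exponential fields (Kirby 2013 §2):
if `f : R → S` is an E-ring morphism of exponential fields of characteristic zero (automatically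
injective, `RingHom.injective`) and `S` has the Schanuel property, then so does `R`, since `f`
preserves `ℚ`-linear independence and transcendence degrees of finitely generated subfields. [cite: Kirby2013, §2] -/
def SchanuelProperty.of_injective : Prop :=
  ∀ (f : ExponentialRingHom R S) (hS : SchanuelProperty S),
    SchanuelProperty R

/-- Schanuel's conjecture for `ℂ` implies the Schanuel property of the real exponential field
(the case `f = ExponentialRingHom.realComplex` of `SchanuelProperty.of_injective`; this is the
hypothesis under which Macintyre–Wilkie 1996 prove decidability of `ℝ_exp`). [cite: MacintyreWilkie1996, prove decidability of  ℝ_exp] -/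
def schanuelProperty_real_of_complex : Prop :=
  ∀ (h : SchanuelProperty ℂ),
    SchanuelProperty ℝ

/- interim proof relied on results that are now named facts (D-0014); demoted to a fact by the M5 import, proof preserved:
:=
  h.of_injective ExponentialRingHom.realComplex
-/

end Schanuel

/-! ### Proofs: transfer of the Schanuel property; the property is not unconditional -/

section SchanuelProofs

universe u v

variable {R : Type u} [Field R] [CharZero R] [ExponentialRing R]
variable {S : Type v} [Field S] [CharZero S] [ExponentialRing S]

/-- An E-ring morphism of exponential fields of characteristic zero transports the field
`ℚ(x, exp x)` generated by a tuple isomorphically onto `ℚ(f x, exp (f x))`, hence preserves its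
transcendence degree over `ℚ` (Kirby 2013 §2: embeddings of E-fields). [cite: Kirby2013, §2] -/
theorem ExponentialRingHom.lift_trdeg_adjoin_eq (f : ExponentialRingHom R S) {n : ℕ}
    (x : Fin n → R) :
    Cardinal.lift.{v} (Algebra.trdeg ℚ
      ↥(IntermediateField.adjoin ℚ (Set.range x ∪ Set.range (ExponentialRing.exp ∘ x)))) =
    Cardinal.lift.{u} (Algebra.trdeg ℚ
      ↥(IntermediateField.adjoin ℚ (Set.range (f ∘ x) ∪
        Set.range (ExponentialRing.exp ∘ (f ∘ x))))) := by
  let g : R →ₐ[ℚ] S := f.toRingHom.toRatAlgHom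
  have hg : ∀ y, g y = f y := fun y => rfl
  have hset : g '' (Set.range x ∪ Set.range (ExponentialRing.exp ∘ x)) =
      Set.range (f ∘ x) ∪ Set.range (ExponentialRing.exp ∘ (f ∘ x)) := by
    rw [Set.image_union, ← Set.range_comp, ← Set.range_comp]
    congr 2
    funext i
    simp [hg]
  have hmap :
      (IntermediateField.adjoin ℚ (Set.range x ∪ Set.range (ExponentialRing.exp ∘ x))).map g =
        IntermediateField.adjoin ℚ (Set.range (f ∘ x) ∪
          Set.range (ExponentialRing.exp ∘ (f ∘ x))) := by
    rw [IntermediateField.adjoin_map, hset]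
  exact ((IntermediateField.equivMap _ g).trans (IntermediateField.equivOfEq hmap)).lift_trdeg_eq

/-- **Discharge** of the transfer fact `SchanuelProperty.of_injective` (Kirby 2013 §2): an E-ring
morphism `f : R → S` of exponential fields of characteristic zero is a `ℚ`-algebra embedding, so it
preserves `ℚ`-linear independence of tuples and the transcendence degree of `ℚ(x, exp x)`; hence the
Schanuel property descends from `S` to `R`. [cite: Kirby2013, §2] -/
theorem SchanuelProperty.of_injective_holds : SchanuelProperty.of_injective (R := R) (S := S) := by
  intro f hS n x hx
  let g : R →ₐ[ℚ] S := f.toRingHom.toRatAlgHom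
  have hinj : Function.Injective g := f.toRingHom.injective
  have hx' : LinearIndependent ℚ (f ∘ x) :=
    hx.map' g.toLinearMap (LinearMap.ker_eq_bot.mpr hinj)
  have h1 := hS n (f ∘ x) hx'
  have h2 := f.lift_trdeg_adjoin_eq x
  rw [← Cardinal.lift_le.{u}, Cardinal.lift_natCast, ← h2] at h1
  rwa [← Cardinal.lift_le.{v}, Cardinal.lift_natCast]

/-- **Discharge** of `schanuelProperty_real_of_complex`: Schanuel's conjecture for `ℂ_exp` implies
the Schanuel property of `ℝ_exp`, by transfer along the E-ring embedding `ℝ → ℂ`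
(`ExponentialRingHom.realComplex`); this is the form in which Macintyre–Wilkie 1996 use Schanuel's
conjecture. [cite: MacintyreWilkie1996, §1] -/
theorem schanuelProperty_real_of_complex_holds : schanuelProperty_real_of_complex :=
  fun h => SchanuelProperty.of_injective_holds ExponentialRingHom.realComplex h

/-- The Schanuel property is a genuine *property* of an exponential field, not a theorem about all
of them: it fails whenever the exponential is trivial (`exp = 1`), since then `x = (1)` is
`ℚ`-linearly independent while `ℚ(1, exp 1) = ℚ` has transcendence degree `0 < 1`. (For `ℂ_exp` the
property is Schanuel's *conjecture*, Lang 1966 pp. 30–31; Baker 1975 p. 112.) [folklore] -/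
theorem not_schanuelProperty_of_exp_eq_one (h : ∀ y : R, ExponentialRing.exp y = 1) :
    ¬ SchanuelProperty R := by
  intro hSP
  have h1 := hSP 1 (fun _ => 1) (by
    rw [Fintype.linearIndependent_iff]
    intro c hc i
    have : c 0 = 0 := by simpa using hc
    fin_cases i; exact this)
  have hbot : IntermediateField.adjoin ℚ
      (Set.range (fun _ : Fin 1 => (1 : R)) ∪
        Set.range (ExponentialRing.exp ∘ fun _ : Fin 1 => (1 : R))) = ⊥ := by
    rw [IntermediateField.adjoin_eq_bot_iff]
    rintro y (⟨i, rfl⟩ | ⟨i, rfl⟩)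
    · exact one_mem _
    · simp only [Function.comp_apply, h]; exact one_mem _
  have h0 : Algebra.trdeg ℚ ↥(IntermediateField.adjoin ℚ
      (Set.range (fun _ : Fin 1 => (1 : R)) ∪
        Set.range (ExponentialRing.exp ∘ fun _ : Fin 1 => (1 : R)))) = 0 := by
    haveI : Algebra.IsAlgebraic ℚ ℚ := ⟨fun q => isAlgebraic_algebraMap q⟩
    have := ((IntermediateField.equivOfEq hbot).trans (IntermediateField.botEquiv ℚ R)).lift_trdeg_eq
    rwa [trdeg_eq_zero (R := ℚ) (A := ℚ), Cardinal.lift_zero, Cardinal.lift_eq_zero] at this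
  have h2 : ((1 : ℕ) : Cardinal) ≤ 0 := h1.trans_eq h0
  exact absurd h2 (by norm_num)

/-- Consequently no unconditional `SchanuelProperty_holds` exists: `ℚ` with the trivial exponential
`exp = 1` is an exponential field of characteristic zero without the Schanuel property. [folklore] -/
theorem exists_exponentialRing_not_schanuelProperty :
    ∃ E : ExponentialRing ℚ, ¬ @SchanuelProperty ℚ _ _ E :=
  ⟨⟨fun _ => 1, rfl, fun _ _ => (one_mul 1).symm⟩,
    @not_schanuelProperty_of_exp_eq_one ℚ _ _ ⟨fun _ => 1, rfl, fun _ _ => (one_mul 1).symm⟩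
      (fun _ => rfl)⟩

end SchanuelProofs

end Literature.ModelTheory.ExponentialFields
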